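import Summits.ResolutionOfSingularities.ResolutionOfSingularities.Theorems.EquisingularLiftEquisingularLiftNatModelSquareRegularStalk
import Summits.ResolutionOfSingularities.ResolutionOfSingularities.Theorems.EquisingularLiftEquisingularLiftNatCarrierDeltaComapFrame
import Summits.ResolutionOfSingularities.ResolutionOfSingularities.Theorems.EquisingularLiftEquisingularLiftNatSpecialFibreCharts
import Literature.AlgebraicGeometry.FormalGeometry.FormalNeighbourhoodTower
import HarnessLib

/-!
# [OURS · L1 W4.5(b) · EL♮(3) · WIDTH TABLE D8 «NODAL HOSTED ROUND (HR-KEEP-N)», support debt S-D8-LIFT, part 4, brick (N-C7)]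
# «ε OFF 𝔪² UPSTAIRS» — at a point of `W₁ = W ×_O O/𝔪²` under a regular point of the special fibre, the germ of the base element `ε = ϖ̄` is a
# regular parameter: `ε̃ ∉ 𝔪²`

res-L1-w45b-stub-2 g19 (STUB WORKER 2), brick NAMED by the plan owner res-L1-w45b-stub-4 g14 (cell bus 2026-08-29T05:10:33Z, «(N-C7) ε off 𝔪²
UPSTAIRS … EXACTLY my (C6a) `hε` shape at `n := 0`»; split of record 2026-08-29T04:20:51Z).  OURS; NOT a statement of any manuscript ([Hironaka2017] is
a candidate under adjudication — nothing of it is asserted here); AI-written, weaker than expert review.  No `sorry`; standard axioms; DEF-FREE.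
`--supports stmt-ResolutionOfSingularities-20148 --as helper`, counted 0.  EL♮(3) is NOT proved; resolution of singularities in positive characteristic
is NOT proved.

WHAT.  DVR currency of J1 (`O` a DVR with uniformizer `ϖ`, `θ : O ↠ k`, `w : W → Spec O` with model square `(jW, tW)`; the infinitesimal neighbourhoods
`W_m = W ×_O O/𝔪^{m+1}` with `ι_m : W_m ↪ W`, `toSpec_m`, the fibre embeddings `e_m : W₀ ↪ W_m`, the transitions `t_m`):
* `ker_stalkMap_ι_le_span_pow` — the stalk map of `ι_m` at any `x ∈ W_m` has kernel `≤ (ϖ̃)^{m+1}`, `ϖ̃` the germ at `ι_m x` of `w♯ϖ` (the ideal of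
  `W_m ↪ W` is `𝔪^{m+1}·𝒪_W`: Mathlib `ker_fst_of_isClosedImmersion`, ✓ `stalkIdeal_ker_eq_ker_stalkMap`, ✓ `stalkIdeal_comap_eq_map_stalkMap`,
  ✓ `ker_appTop_specMap`).
* `stalkMap_ι_germ_pow` — it sends `ϖ̃^j` to the germ `ε̃ⱼ` at `x` of `toSpec_m♯(ϖ̄^j)` (`pullback.condition`, `ΓSpecIso` naturality).
* ★ `germ_transition_base_notMem_sq` — (N-C7): `[Flat w] [IsLocallyNoetherian W]`, `z₀ ∈ W₀` with `𝒪_{W₀,z₀}` REGULAR, level `n` WITH `n = 0` (stated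
  at a variable level to keep the numeral `𝔪 ^ 2` out of the types — the (π)/(C6a) trap): the germ at `x = t_n (e_n z₀) ∈ W_{n+1}` of
  `toSpec_{n+1}♯(ϖ̄^{n+1})` is NOT in `𝔪_x²` — VERBATIM the hypothesis `hε` of res-L1-w45b-stub-4's (C6a) `exists_firstOrder_lift_not_le_sq` at `n := 0`.
  Proof: `ι_{n+1} x = jW z₀`; by ✓ (N-C2′) `ModelSquare.germ_notMem_sq` the germ `ϖ̃ ∈ 𝒪_{W, jW z₀}` is off `𝔪²`; the stalk map `φ` of the closed
  immersion `ι_{n+1}` is surjective and local, so `𝔪_x² = φ(𝔪²)`; if `ε̃ = φ(ϖ̃^{n+1}) ∈ 𝔪_x²` then `ϖ̃^{n+1} ∈ 𝔪² + ker φ ⊆ 𝔪² + (ϖ̃)^{n+2} = 𝔪²`, and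
  `n = 0` gives `ϖ̃ ∈ 𝔪²`, contradiction.
References (method / index only): H. Matsumura, *Commutative Ring Theory* (1986), Thm. 14.2; R. Hartshorne, *Deformation Theory* (2010), proof of
Thm. 22.3 (the tower `W ×_O O/𝔪^{n+1}`).
-/

set_option linter.dupNamespace false -- mandated namespace `Summit.<Summit>.<Problem>` of this single-conjunct summit

noncomputable section

open CategoryTheory CategoryTheory.Limits AlgebraicGeometry TopologicalSpace IsLocalRing
open Literature.AlgebraicGeometry.Morphisms
open Literature.AlgebraicGeometry.Resolution
open Literature.AlgebraicGeometry.FormalGeometry (FormalNeighbourhoodTower.ker_appTop_specMap)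
open Summit.ResolutionOfSingularities.ResolutionOfSingularities.Cruxes.EquisingularLift.StrataSplit

namespace Summit.ResolutionOfSingularities.ResolutionOfSingularities.Cruxes.EquisingularLiftNat.Sections

/-! ## The stalk maps of `ι_m : W_m ↪ W` -/

section IotaStalk

variable (O : Type) [CommRing O] [IsDomain O] [IsDiscreteValuationRing O] {W : Scheme.{0}} (w : W ⟶ Spec (.of O))
  (ϖ : O) (hϖ : Irreducible ϖ)

include hϖ in
/-- **The kernel of the stalk map of `ι_m : W_m ↪ W` is inside `(ϖ̃)^{m+1}`** (`ϖ̃` the germ of `w♯ϖ` at `ι_m x`): the ideal of `W_m = W ×_O O/𝔪^{m+1}`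
in `W` is `𝔪^{m+1}·𝒪_W = (ϖ^{m+1})·𝒪_W`. [folklore] -/
theorem ker_stalkMap_ι_le_span_pow (m : ℕ) (x : infinitesimalNeighbourhood (maximalIdeal O) w m) :
    RingHom.ker ((infinitesimalNeighbourhood.ι (maximalIdeal O) w m).stalkMap x).hom ≤
      Ideal.span {(W.presheaf.Γgerm ((infinitesimalNeighbourhood.ι (maximalIdeal O) w m).base x)).hom
        (w.appTop.hom ((Scheme.ΓSpecIso (.of O)).inv.hom ϖ))} ^ (m + 1) := by
  -- `ker ι♯_x = (ker ι)_{ι x}` and `ker ι = (ker (Spec O/𝔪^{m+1} → Spec O))·𝒪_W`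
  rw [← stalkIdeal_ker_eq_ker_stalkMap (infinitesimalNeighbourhood.ι (maximalIdeal O) w m) x]
  have hker : (infinitesimalNeighbourhood.ι (maximalIdeal O) w m).ker = (infinitesimalNeighbourhood.base (maximalIdeal O) m).ker.comap w :=
    Scheme.IdealSheafData.ker_fst_of_isClosedImmersion _ _
  change stalkIdeal (infinitesimalNeighbourhood.ι (maximalIdeal O) w m).ker ((infinitesimalNeighbourhood.ι (maximalIdeal O) w m).base x) ≤ _
  rw [hker, stalkIdeal_comap_eq_map_stalkMap]
  -- the stalk of `(Spec mk).ker` at `s = w (ι x)`: germs of `ker (Spec mk)♯_⊤ = (𝔪^{m+1})·Γ(Spec O, ⊤)`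
  have htop : ((infinitesimalNeighbourhood.base (maximalIdeal O) m).ker).ideal ⟨⊤, isAffineOpen_top (Spec (.of O))⟩ =
      (maximalIdeal O ^ (m + 1)).map (Scheme.ΓSpecIso (.of O)).inv.hom := by
    rw [Scheme.Hom.ker_apply (infinitesimalNeighbourhood.base (maximalIdeal O) m) ⟨⊤, isAffineOpen_top (Spec (.of O))⟩]
    change RingHom.ker (infinitesimalNeighbourhood.base (maximalIdeal O) m).appTop.hom = _
    rw [FormalNeighbourhoodTower.ker_appTop_specMap, CommRingCat.hom_ofHom, Ideal.mk_ker]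
  have hpow : (maximalIdeal O ^ (m + 1)).map (Scheme.ΓSpecIso (.of O)).inv.hom =
      Ideal.span {(Scheme.ΓSpecIso (.of O)).inv.hom ϖ ^ (m + 1)} := by
    rw [hϖ.maximalIdeal_eq, Ideal.span_singleton_pow, Ideal.map_span, Set.image_singleton, map_pow]
  rw [stalkIdeal_eq_map_germ _ ⟨⊤, isAffineOpen_top (Spec (.of O))⟩ (Set.mem_univ _), htop, hpow,
    Ideal.map_span, Set.image_singleton, Ideal.map_span, Set.image_singleton, map_pow, map_pow, ← Ideal.span_singleton_pow]
  refine le_of_eq ?_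
  congr 3
  -- `w♯_{ι x} (germ_s (ΓSpecIso⁻¹ ϖ)) = germ_{ι x} (w♯ (ΓSpecIso⁻¹ ϖ))`
  exact stalkMap_Γgerm_apply' w ((infinitesimalNeighbourhood.ι (maximalIdeal O) w m).base x) _

/-- **The stalk map of `ι_m` sends `ϖ̃^j` to the germ of `toSpec_m♯(ϖ̄^j)`** (`ι_m ≫ w = toSpec_m ≫ Spec (O → O/𝔪^{m+1})`). [folklore] -/
theorem stalkMap_ι_germ_pow (m : ℕ) (x : infinitesimalNeighbourhood (maximalIdeal O) w m) (j : ℕ) :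
    ((infinitesimalNeighbourhood.ι (maximalIdeal O) w m).stalkMap x).hom
        ((W.presheaf.Γgerm ((infinitesimalNeighbourhood.ι (maximalIdeal O) w m).base x)).hom (w.appTop.hom ((Scheme.ΓSpecIso (.of O)).inv.hom ϖ)) ^ j) =
      ((infinitesimalNeighbourhood (maximalIdeal O) w m).presheaf.Γgerm x).hom
        ((infinitesimalNeighbourhood.toSpec (maximalIdeal O) w m).appTop.hom
          ((Scheme.ΓSpecIso (.of (O ⧸ maximalIdeal O ^ (m + 1)))).inv.hom (Ideal.Quotient.mk _ (ϖ ^ j)))) := by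
  -- `ι♯ (w♯ s) = toSpec♯ ((Spec mk)♯ s)` and `(Spec mk)♯ (ΓSpecIso⁻¹ ϖ) = ΓSpecIso⁻¹ (mk ϖ)`
  have h1 := congrArg (fun g => g.appTop.hom ((Scheme.ΓSpecIso (.of O)).inv.hom ϖ))
    (pullback.condition (f := w) (g := infinitesimalNeighbourhood.base (maximalIdeal O) m))
  simp only [Scheme.Hom.comp_appTop, CommRingCat.hom_comp, RingHom.comp_apply] at h1
  have h2 := congrArg (fun g => g.hom ϖ) (Scheme.ΓSpecIso_inv_naturality (CommRingCat.ofHom (Ideal.Quotient.mk (maximalIdeal O ^ (m + 1)))))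
  simp only [CommRingCat.hom_comp, RingHom.comp_apply, CommRingCat.hom_ofHom] at h2
  have hbase : (infinitesimalNeighbourhood.ι (maximalIdeal O) w m).appTop.hom (w.appTop.hom ((Scheme.ΓSpecIso (.of O)).inv.hom ϖ)) =
      (infinitesimalNeighbourhood.toSpec (maximalIdeal O) w m).appTop.hom
        ((Scheme.ΓSpecIso (.of (O ⧸ maximalIdeal O ^ (m + 1)))).inv.hom (Ideal.Quotient.mk _ ϖ)) := by
    rw [h1, ← h2]
  rw [map_pow, stalkMap_Γgerm_apply', hbase, ← map_pow, ← map_pow, ← map_pow, ← map_pow]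

end IotaStalk

/-! ## (N-C7): `ε̃ ∉ 𝔪²` at the points of `W_{n+1}` under the regular points of the special fibre (`n = 0`) -/

/-- ★ **(N-C7) «ε OFF 𝔪² UPSTAIRS».**  Model square `(jW, tW; w, Spec θ)` over the DVR `O` (`θ` surjective, `hI : 𝔪 ≤ ker θ`, `ϖ` a uniformizer), `w`
flat, `W` locally Noetherian, `z₀ ∈ W₀` with `𝒪_{W₀,z₀}` regular, and a level `n` with `n = 0`: the germ at `x = t_n (e_n z₀) ∈ W_{n+1}` of the base
element `toSpec_{n+1}♯(ϖ̄^{n+1})` is not in `𝔪_x²` — the hypothesis `hε` of (C6a) `exists_firstOrder_lift_not_le_sq` at `n := 0`.  See the module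
docstring for the proof. [cite: Matsumura1987, Thm. 14.2] [OURS · L1 W4.5b · WIDTH TABLE D8, support debt S-D8-LIFT, brick (N-C7); counted 0] -/
theorem germ_transition_base_notMem_sq
    (O : Type) [CommRing O] [IsDomain O] [IsDiscreteValuationRing O] {k : Type} [Field k] (θ : O →+* k) (hθ : Function.Surjective θ)
    (hI : maximalIdeal O ≤ RingHom.ker θ)
    {W : Scheme.{0}} (w : W ⟶ Spec (.of O)) [Flat w] [IsLocallyNoetherian W] {W₀ : Scheme.{0}} (jW : W₀ ⟶ W) (tW : W₀ ⟶ Spec (.of k))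
    (hsq : IsPullback jW tW w (Spec.map (CommRingCat.ofHom θ))) (ϖ : O) (hϖ : Irreducible ϖ)
    (z₀ : W₀) (hz₀ : IsRegularLocalRing (W₀.presheaf.stalk z₀)) (n : ℕ) (hn : n = 0) :
    ((infinitesimalNeighbourhood (maximalIdeal O) w (n + 1)).presheaf.Γgerm
        ((infinitesimalNeighbourhood.transition (maximalIdeal O) w n).base ((fibreEmb (maximalIdeal O) w θ hI hsq n).base z₀))).hom
      ((infinitesimalNeighbourhood.toSpec (maximalIdeal O) w (n + 1)).appTop.hom
        ((Scheme.ΓSpecIso (.of (O ⧸ maximalIdeal O ^ (n + 1 + 1)))).inv.hom (Ideal.Quotient.mk _ (ϖ ^ (n + 1))))) ∉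
      maximalIdeal ((infinitesimalNeighbourhood (maximalIdeal O) w (n + 1)).presheaf.stalk
        ((infinitesimalNeighbourhood.transition (maximalIdeal O) w n).base ((fibreEmb (maximalIdeal O) w θ hI hsq n).base z₀))) ^ 2 := by
  subst hn
  haveI := hz₀
  intro hmem
  -- the point `x ∈ W₁` and its image `ι₁ x = jW z₀`
  have hpt : (infinitesimalNeighbourhood.ι (maximalIdeal O) w (0 + 1)).base
      ((infinitesimalNeighbourhood.transition (maximalIdeal O) w 0).base ((fibreEmb (maximalIdeal O) w θ hI hsq 0).base z₀)) = jW.base z₀ := by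
    rw [← Scheme.Hom.comp_apply, infinitesimalNeighbourhood.transition_ι, ← Scheme.Hom.comp_apply, fibreEmb_ι]
  -- `ϖ̃ ∉ 𝔪²` and `ϖ̃ ∈ 𝔪` at `ι₁ x` ((N-C2′))
  have key : (W.presheaf.Γgerm ((infinitesimalNeighbourhood.ι (maximalIdeal O) w (0 + 1)).base
      ((infinitesimalNeighbourhood.transition (maximalIdeal O) w 0).base ((fibreEmb (maximalIdeal O) w θ hI hsq 0).base z₀)))).hom
        (w.appTop.hom ((Scheme.ΓSpecIso (.of O)).inv.hom ϖ)) ∉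
      maximalIdeal (W.presheaf.stalk ((infinitesimalNeighbourhood.ι (maximalIdeal O) w (0 + 1)).base
        ((infinitesimalNeighbourhood.transition (maximalIdeal O) w 0).base ((fibreEmb (maximalIdeal O) w θ hI hsq 0).base z₀)))) ^ 2 := by
    rw [hpt]
    exact ModelSquare.germ_notMem_sq O θ hθ w jW tW hsq z₀ ϖ hϖ
  have hmax : (W.presheaf.Γgerm ((infinitesimalNeighbourhood.ι (maximalIdeal O) w (0 + 1)).base
      ((infinitesimalNeighbourhood.transition (maximalIdeal O) w 0).base ((fibreEmb (maximalIdeal O) w θ hI hsq 0).base z₀)))).hom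
        (w.appTop.hom ((Scheme.ΓSpecIso (.of O)).inv.hom ϖ)) ∈
      maximalIdeal (W.presheaf.stalk ((infinitesimalNeighbourhood.ι (maximalIdeal O) w (0 + 1)).base
        ((infinitesimalNeighbourhood.transition (maximalIdeal O) w 0).base ((fibreEmb (maximalIdeal O) w θ hI hsq 0).base z₀)))) := by
    rw [hpt]
    exact ModelSquare.germ_mem_maximalIdeal O θ hθ w jW tW hsq z₀ ϖ hϖ
  -- from now on `x` and the stalk map `φ` of `ι₁` at `x` (surjective, local, `φ (ϖ̃^1) = ε̃`)
  generalize hx : (infinitesimalNeighbourhood.transition (maximalIdeal O) w 0).base ((fibreEmb (maximalIdeal O) w θ hI hsq 0).base z₀) = x at hmem key hmax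
  have hsurj : Function.Surjective ((infinitesimalNeighbourhood.ι (maximalIdeal O) w (0 + 1)).stalkMap x).hom :=
    (infinitesimalNeighbourhood.ι (maximalIdeal O) w (0 + 1)).stalkMap_surjective x
  have hloc : IsLocalHom ((infinitesimalNeighbourhood.ι (maximalIdeal O) w (0 + 1)).stalkMap x).hom := inferInstance
  rw [← stalkMap_ι_germ_pow O w ϖ (0 + 1) x (0 + 1)] at hmem
  -- `𝔪_x² = φ(𝔪²)`
  have hcomap : (maximalIdeal _).comap ((infinitesimalNeighbourhood.ι (maximalIdeal O) w (0 + 1)).stalkMap x).hom = maximalIdeal _ :=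
    ((IsLocalRing.local_hom_TFAE ((infinitesimalNeighbourhood.ι (maximalIdeal O) w (0 + 1)).stalkMap x).hom).out 0 4).mp hloc
  have hmap : (maximalIdeal _).map ((infinitesimalNeighbourhood.ι (maximalIdeal O) w (0 + 1)).stalkMap x).hom =
      maximalIdeal ((infinitesimalNeighbourhood (maximalIdeal O) w (0 + 1)).presheaf.stalk x) := by
    rw [← hcomap, Ideal.map_comap_of_surjective _ hsurj]
  rw [← hmap, ← Ideal.map_pow] at hmem
  obtain ⟨v, hv, hφv⟩ := (Ideal.mem_map_iff_of_surjective _ hsurj).mp hmem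
  -- `ϖ̃^1 - v ∈ ker φ ⊆ (ϖ̃)^2 ⊆ 𝔪²`
  have hdiff : (W.presheaf.Γgerm ((infinitesimalNeighbourhood.ι (maximalIdeal O) w (0 + 1)).base x)).hom
      (w.appTop.hom ((Scheme.ΓSpecIso (.of O)).inv.hom ϖ)) ^ (0 + 1) - v ∈
      RingHom.ker ((infinitesimalNeighbourhood.ι (maximalIdeal O) w (0 + 1)).stalkMap x).hom := by
    rw [RingHom.mem_ker, map_sub, hφv, sub_self]
  have hk := ker_stalkMap_ι_le_span_pow O w ϖ hϖ (0 + 1) x hdiff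
  have hle : Ideal.span {(W.presheaf.Γgerm ((infinitesimalNeighbourhood.ι (maximalIdeal O) w (0 + 1)).base x)).hom
      (w.appTop.hom ((Scheme.ΓSpecIso (.of O)).inv.hom ϖ))} ^ (0 + 1 + 1) ≤ maximalIdeal _ ^ 2 :=
    (Ideal.pow_right_mono ((Ideal.span_singleton_le_iff_mem _).mpr hmax) _).trans (Ideal.pow_le_pow_right (by omega))
  have hmem' : (W.presheaf.Γgerm ((infinitesimalNeighbourhood.ι (maximalIdeal O) w (0 + 1)).base x)).hom
      (w.appTop.hom ((Scheme.ΓSpecIso (.of O)).inv.hom ϖ)) ^ (0 + 1) ∈ maximalIdeal _ ^ 2 := by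
    have h := Ideal.add_mem _ (hle hk) hv
    rwa [sub_add_cancel] at h
  have h1 : (W.presheaf.Γgerm ((infinitesimalNeighbourhood.ι (maximalIdeal O) w (0 + 1)).base x)).hom
      (w.appTop.hom ((Scheme.ΓSpecIso (.of O)).inv.hom ϖ)) ^ (0 + 1) = (W.presheaf.Γgerm ((infinitesimalNeighbourhood.ι (maximalIdeal O) w (0 + 1)).base x)).hom
      (w.appTop.hom ((Scheme.ΓSpecIso (.of O)).inv.hom ϖ)) := pow_one _
  rw [h1] at hmem'
  exact key hmem'

end Summit.ResolutionOfSingularities.ResolutionOfSingularities.Cruxes.EquisingularLiftNat.Sections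

end
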